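import Literature.NumberTheory.Automorphic.Liu2021.Thm418AsPrinted
import Mathlib.LinearAlgebra.DirectSum.Finsupp
import Mathlib.LinearAlgebra.FreeModule.Basic
import Mathlib.RepresentationTheory.Basic
import HarnessLib

/-!
# [Liu 2021, Thm. 4.18] AS PRINTED ⟹ the «combined reading» r8 (`Thm418Combined` / `Thm418C`), modulo the proof map (4.3)

HM-EQUALITY Δ2 (hodge-director/HM-EQUALITY.md §4.3, coordinator ruling 2026-08-21T19:17:21Z): the stage-1 package consumes
[Liu2021, Thm. 4.18] through the COMBINED READING r8 `LiuAlbaneseModuleDatum.Thm418Combined res cmCl`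
(`HodgeCM/Literature/AlbaneseUnitaryShimuraModules.lean`:168; model instance `LiuDictionary.Thm418C`, `Model/LiuDictionary.lean`:210):

  «for every `μ` with `τ' ∈ Φ_μ` there is a level `K₀` such that for every `K ≤ K₀`, every `K`-fixed vector of the `μ`-block of
   `H = H¹_{B,τ'}(A_∞, ℂ)` restricts, on the level-`K` geometric side `W K`, into the span of the CM classes `cmCl K μ`»,

whereas the tree's cite is the statement EXACTLY AS PRINTED, `Liu2021.Thm418AsPrinted D` (`Thm418AsPrinted.lean`, p277833).  The tree
file `Literature/RepresentationTheory/Liu2021/AlbaneseBlockMultiplicityOne.lean` (`combinedReading_of_block_le_range`,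
`combinedReading_of_rank_hom_le_one`) already reduces the r8 shape to (i) `block μ ≤ range j` for an injective equivariant map `j` into
`H` (multiplicity one, [Liu2021] proof of Prop. 4.13, l. 2145) and (ii) a hypothesis `hmap`: «below some level, the `K`-fixed vectors in
the image of `j` restrict into `span (cmCl K)`».  THIS FILE derives exactly that `hmap` from `Thm418AsPrinted D` — its item (1),
«`Ω(μ)^K ≃ Hom_E(A_K, A_μ)_ℚ` for every sufficiently small open compact `K`» (l. 2239) — for the map `j := J`, where

* `J : Ω(μ) ⊗_{M_μ} ℂ → H` is THE PROOF'S MAP (4.3) of [Liu2021] Thm. 4.18 (`FJcycle.tex` l. 2247–2266: «`f ⊗ z ↦ z · f^*α` … by pulling back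
  `α`», injective, `𝔾(𝔸_F^∞)`-equivariant) — PRINTED in the proof, NOT in the statement, hence an explicit carrier here with its two
  printed properties `hJ` (equivariance) and `hJinj` (injectivity) as binders; and
* `hpin` is the IDENTIFICATION of the consumer's CM classes: the class of `φ ∈ Hom_E(A_K, A_μ)_ℚ` on `W K` — `resW K (J (1 ⊗ res K D_μ φ))`,
  i.e. `(f^*α)|_{P_K}` by Lem. 2.4 (1) (l. 1210–1213) and functoriality of Betti `H¹` — belongs to `cmCl K` (the consumer instantiates
  `cmCl` by comprehension over Liu's CM data, `Model/LiuDictionary.lean` CONTRACT on `adm`; the statement is monotone in `cmCl`).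

HONEST FINDING recorded here (for the ruling's formula «CITE [Liu 4.18] AS PRINTED»): `Thm418AsPrinted D` ALONE does not imply the r8
reading — the printed STATEMENT provides an ABSTRACT isomorphism `Ω(μ) ⊗_{M_μ} ℂ ≃ ⊕ ω(μ,ε,χ)`; the reading uses the PROOF's map (4.3)
into `H¹_{B,τ'}(A_∞, ℂ)`.  With (4.3) as a carrier + its two printed properties, item (1) of the printed statement is exactly what
discharges `hmap`; the main statement + Prop. 4.13's multiplicity one then give `block μ ≤ range J` (consumer side, tree
`combinedReading_of_block_le_range`).

KERNEL CONTENT: one module-algebra lemma — the `K`-fixed vectors of `ℂ ⊗_{M_μ} Ω(μ)` (for `K` acting on `Ω(μ)`, trivially on `ℂ`) lie in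
the `ℂ`-span of the `1 ⊗ w`, `w ∈ Ω(μ)^K` (coordinates along an `M_μ`-basis of `ℂ`, `TensorProduct.finsuppScalarLeft`) — and bookkeeping:
item (1) at an open compact `Kof K` below its threshold (`Set.range (res K D_μ) = Ω(μ)^K`), equivariance + injectivity of `J` to move
fixedness from `H` to `ℂ ⊗ Ω(μ)`, `ℂ`-linearity of `J` and `resW K`.  Theorems only; no definition, no named fact, nothing asserted.
HC_CM is NOT proved; this file discharges NO binder of the COR-CM chain by itself (it re-bases the package's `Thm418C` input on the
as-printed cite PLUS the (4.3) carrier and the class identification `hpin`, both of which remain the consumer's).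

References: Y. Liu, *Fourier–Jacobi cycles and arithmetic relative trace formula*, Camb. J. Math. 9 (2021) = arXiv:2102.11518,
`FJcycle.tex` md5 6db49a74122d: Thm. 4.18 l. 2232–2245 (item (1) l. 2238–2239), proof l. 2247–2270 (map (4.3) l. 2247–2266),
Rem. 4.17 l. 2226–2228, Lem. 2.4 (1) l. 1210–1213, Prop. 4.13 l. 2113–2119 with proof l. 2145.
-/

noncomputable section

open scoped TensorProduct
open NumberField TensorProduct

namespace Literature.NumberTheory.Automorphic.Liu2021

/-! ## Module algebra: fixed vectors of `A ⊗_R N` under `1 ⊗ f` lie in the `A`-span of `1 ⊗ N^f` -/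

/-- **Fixed vectors of a base change are spanned by base changes of fixed vectors.**  `R` a field, `A` a commutative `R`-algebra,
`N` an `R`-module, `f i : N →ₗ[R] N` a family of endomorphisms.  If `x ∈ A ⊗_R N` is fixed by every `(f i) ⊗ 1`-base-change
`(f i).baseChange A`, then `x` lies in the `A`-span of the elements `1 ⊗ n` with `n` fixed by every `f i`: along an `R`-basis `b` of `A`,
`A ⊗_R N ≅ ⊕_b N` compatibly with the action (`TensorProduct.finsuppScalarLeft`), each coordinate of `x` is fixed, and
`x = Σ_i b_i ⊗ x_i = Σ_i b_i • (1 ⊗ x_i)`.  (Private helper.) [folklore] -/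
private theorem mem_span_one_tmul_of_baseChange_fixed {R : Type*} [Field R] {A : Type*} [CommRing A] [Algebra R A]
    {N : Type*} [AddCommGroup N] [Module R N] {ι : Sort*} (f : ι → (N →ₗ[R] N)) {x : A ⊗[R] N}
    (hfix : ∀ i, (f i).baseChange A x = x) :
    x ∈ Submodule.span A {t : A ⊗[R] N | ∃ n : N, (∀ i, f i n = n) ∧ t = (1 : A) ⊗ₜ[R] n} := by
  classical
  let b := Module.Free.chooseBasis R A
  let e : A ⊗[R] N ≃ₗ[R] (Module.Free.ChooseBasisIndex R A →₀ N) :=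
    (TensorProduct.congr b.repr (LinearEquiv.refl R N)).trans
      (TensorProduct.finsuppScalarLeft R N (Module.Free.ChooseBasisIndex R A))
  -- `e` intertwines `1 ⊗ g` (`g.baseChange A`) with the coordinatewise action of `g`
  have key : ∀ (g : N →ₗ[R] N) (y : A ⊗[R] N) (j : Module.Free.ChooseBasisIndex R A),
      e (g.baseChange A y) j = g (e y j) := by
    intro g y j
    induction y using TensorProduct.induction_on with
    | zero => simp only [map_zero, Finsupp.coe_zero, Pi.zero_apply]
    | tmul a n =>
      simp only [e, LinearMap.baseChange_tmul, LinearEquiv.trans_apply, TensorProduct.congr_tmul,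
        LinearEquiv.refl_apply, TensorProduct.finsuppScalarLeft_apply_tmul_apply, map_smul]
    | add y z hy hz => simp only [map_add, Finsupp.coe_add, Pi.add_apply, hy, hz]
  -- `e` sends `b j ⊗ n` to `single j n`
  have e_tmul : ∀ (j : Module.Free.ChooseBasisIndex R A) (n : N), e (b j ⊗ₜ[R] n) = Finsupp.single j n := by
    intro j n
    ext j'
    simp only [e, LinearEquiv.trans_apply, TensorProduct.congr_tmul, LinearEquiv.refl_apply, Module.Basis.repr_self,
      TensorProduct.finsuppScalarLeft_apply_tmul_apply]
    by_cases h : j = j'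
    · subst h; simp
    · simp [h]
  -- each coordinate of `x` is fixed
  have hcoord : ∀ (j : Module.Free.ChooseBasisIndex R A) (i : ι), f i (e x j) = e x j := by
    intro j i
    have h1 := key (f i) x j
    rw [hfix i] at h1
    exact h1.symm
  -- `x = Σ_j b j ⊗ (e x) j`
  have hx : x = (e x).sum fun j n => b j ⊗ₜ[R] n := by
    apply e.injective
    rw [map_finsuppSum]
    conv_lhs => rw [← Finsupp.sum_single (e x)]
    refine Finsupp.sum_congr fun j _ => ?_
    rw [e_tmul]
  rw [hx, Finsupp.sum]
  refine Submodule.sum_mem _ fun j _ => ?_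
  have hsm : b j ⊗ₜ[R] (e x j) = (b j) • ((1 : A) ⊗ₜ[R] (e x j)) := by
    rw [TensorProduct.smul_tmul', smul_eq_mul, mul_one]
  rw [hsm]
  exact Submodule.smul_mem _ _ (Submodule.subset_span ⟨e x j, fun i => hcoord j i, rfl⟩)

/-! ## The bridge: item (1) of Thm. 4.18 AS PRINTED + the proof map (4.3) ⟹ the `hmap` clause of the combined reading -/

namespace Thm418Data

variable {F E : Type} [Field F] [NumberField F] [IsTotallyReal F] [Field E] [NumberField E] [Algebra F E]
  [IsTotallyComplex E] [Algebra.IsQuadraticExtension F E] {D : Thm418Data F E}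

/-- **[Liu2021, Thm. 4.18 (1)] AS PRINTED discharges the `hmap` clause of the combined reading r8 for the proof's map (4.3).**
Data: the datum `D` of Thm. 4.18 with THE CITE `h : Thm418AsPrinted D`; ONE object `D_μ ∈ 𝒜(μ)` (Prop. 4.6 (1)); a level
preorder `Lvl` with its open compact subgroups `Kof K ≤ 𝔾(𝔸_F^∞)` (monotone, cofinal among open compact subgroups — «sufficiently
small», l. 2239 / §4.2 l. 2060); the consumer's `ℂ[𝔾(𝔸_F^∞)]`-module `H` (intended `H¹_{B,τ'}(A_∞, ℂ)`, §4.2 l. 2070–2074) with its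
geometric side `resW K : H → W K` (restriction to the level-`K` component, intended `H¹(P_K; ℂ)`) and CM classes `cmCl K ⊆ W K`;
THE PROOF'S MAP (4.3) `J : Ω(μ) ⊗_{M_μ} ℂ → H`, «`f ⊗ z ↦ z · f^*α`» (l. 2247–2250), with its two printed properties —
`hJ` equivariance and `hJinj` «(4.3) is injective» (l. 2252–2262) — and the class identification `hpin`: for
`φ ∈ Hom_E(A_K, A_μ)_ℚ`, the level-`K` restriction of `J(φ ⊗ 1) = φ^*α` is one of the consumer's CM classes (Lem. 2.4 (1)
l. 1210–1213: `H¹_{B,τ'}(A_K) = H¹_{B,τ'}(X_K)`; functoriality of Betti `H¹`).  CONCLUSION = the hypothesis `hmap` of the tree's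
`Literature.RepresentationTheory.Liu2021.combinedReading_of_block_le_range` for `j := J`: below some level `K₀`, every vector of
`range J` fixed by `Kof K` restricts into `span ℂ (cmCl K)`.  PROOF: item (1) of the printed statement at the open compact `Kof K`
below its threshold (`Set.range (res K D_μ) = Ω(μ)^K`), fixedness moved from `H` to `Ω(μ) ⊗ ℂ` by `hJ`/`hJinj`, and
`mem_span_one_tmul_of_baseChange_fixed`.  Nothing about Liu's objects is constructed; `J`, `hJ`, `hJinj`, `hpin` stay the
consumer's.  HC_CM is NOT proved.
[cite: Liu2021, Thm. 4.18 (1) (FJcycle.tex l. 2238–2239) with proof map (4.3) (l. 2247–2266); Lem. 2.4 (1) (l. 1210–1213)] -/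
theorem resW_mem_span_of_fixed_of_thm418AsPrinted (h : Liu2021.Thm418AsPrinted D) (Dμ : D.Obj)
    {Lvl : Type*} [Preorder Lvl] (Kof : Lvl → Subgroup D.G)
    (hmono : ∀ ⦃K K' : Lvl⦄, K ≤ K' → Kof K ≤ Kof K') (hoc : ∀ K : Lvl, IsOpenCompact (Kof K))
    (hcof : ∀ K' : Subgroup D.G, IsOpenCompact K' → ∃ K₀ : Lvl, Kof K₀ ≤ K')
    {H : Type*} [AddCommGroup H] [Module ℂ H] (ρH : Representation ℂ D.G H)
    {W : Lvl → Type*} [∀ K, AddCommGroup (W K)] [∀ K, Module ℂ (W K)]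
    (resW : ∀ K : Lvl, H →ₗ[ℂ] W K) (cmCl : ∀ K : Lvl, Set (W K))
    (J : ℂ ⊗[fieldOfValues E D.μ] D.Ω →ₗ[ℂ] H)
    (hJ : ∀ (g : D.G) (x : ℂ ⊗[fieldOfValues E D.μ] D.Ω), J ((D.rhoΩ g).baseChange ℂ x) = ρH g (J x))
    (hJinj : Function.Injective J)
    (hpin : ∀ (K : Lvl) (φ : D.HomK (Kof K) Dμ),
      resW K (J ((1 : ℂ) ⊗ₜ[fieldOfValues E D.μ] D.res (Kof K) Dμ φ)) ∈ cmCl K) :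
    ∃ K₀ : Lvl, ∀ K ≤ K₀, ∀ x : ℂ ⊗[fieldOfValues E D.μ] D.Ω,
      (∀ k ∈ Kof K, ρH k (J x) = J x) → resW K (J x) ∈ Submodule.span ℂ (cmCl K) := by
  -- item (1) of the printed statement for the object `Dμ`
  obtain ⟨-, -, h1, -, -⟩ := h
  obtain ⟨K₀', hK₀', hsmall⟩ := h1 Dμ
  obtain ⟨K₀, hK₀⟩ := hcof K₀' hK₀'
  refine ⟨K₀, fun K hK x hxfix => ?_⟩
  have hrange : Set.range (D.res (Kof K) Dμ) = D.invariants (Kof K) :=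
    (hsmall (Kof K) (hoc K) ((hmono hK).trans hK₀)).2
  -- fixedness on the `Ω(μ) ⊗ ℂ` side, by equivariance and injectivity of (4.3)
  have hfixΩ : ∀ k : Kof K, (D.rhoΩ (k : D.G)).baseChange ℂ x = x := by
    intro k
    apply hJinj
    rw [hJ, hxfix k k.2]
  -- `x` lies in the `ℂ`-span of the `1 ⊗ w`, `w ∈ Ω(μ)^K`
  have hx := mem_span_one_tmul_of_baseChange_fixed (fun k : Kof K => D.rhoΩ (k : D.G)) hfixΩ
  -- push through the `ℂ`-linear map `resW K ∘ J`: each generator `1 ⊗ w`, `w = res K Dμ φ`, lands in `cmCl K` (`hpin`)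
  have hsub : Submodule.span ℂ {t : ℂ ⊗[fieldOfValues E D.μ] D.Ω |
        ∃ n : D.Ω, (∀ i : Kof K, D.rhoΩ (i : D.G) n = n) ∧ t = (1 : ℂ) ⊗ₜ[fieldOfValues E D.μ] n} ≤
      (Submodule.span ℂ (cmCl K)).comap ((resW K).comp J) := by
    refine Submodule.span_le.mpr ?_
    rintro t ⟨n, hn, rfl⟩
    have hninv : n ∈ D.invariants (Kof K) := (D.mem_invariants_iff _ _).2 fun k hk => hn ⟨k, hk⟩
    rw [← hrange] at hninv
    obtain ⟨φ, hφ⟩ := hninv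
    rw [SetLike.mem_coe, Submodule.mem_comap, LinearMap.comp_apply, ← hφ]
    exact Submodule.subset_span (hpin K φ)
  exact Submodule.mem_comap.1 (hsub hx)

/-- **The combined reading r8 at one `μ`, from [Liu2021, Thm. 4.18] AS PRINTED + the proof map (4.3) + «block ≤ range (4.3)».**
Same data as `resW_mem_span_of_fixed_of_thm418AsPrinted`, plus the consumer's `μ`-block `block ≤ H` with `hblock : block ≤ range J`
— the READING of the proof's «(4.3) … induces the isomorphism» onto `⊕_{ε,χ} ω(μ,ε,χ) ⊆ H¹_{B,τ'}(A_∞, ℂ)` (l. 2262–2266) together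
with multiplicity one (proof of Prop. 4.13, l. 2145; in the tree: `Literature.RepresentationTheory.Liu2021.iSup_iSup_range_le_range_of_rank_hom_le_one`
supplies `hblock` for the package's intrinsic block `⨆_a ⨆_ψ range ψ`).  CONCLUSION = the package's `Thm418Combined res cmCl` at this `μ`
(`HodgeCM/Literature/AlbaneseUnitaryShimuraModules.lean`:168) with `fixedBy (Kof K) H` unfolded to `∀ k ∈ Kof K, ρH k x = x`:
«there is a level `K₀` such that for every `K ≤ K₀`, every `Kof K`-fixed vector of the block restricts into `span ℂ (cmCl K)`».
HC_CM is NOT proved; `J`/`hJ`/`hJinj`/`hpin`/`hblock` remain the consumer's.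
[cite: Liu2021, Thm. 4.18 (1) (FJcycle.tex l. 2238–2239) with proof (l. 2247–2266); Prop. 4.13, proof l. 2145] -/
theorem block_resW_mem_span_of_thm418AsPrinted (h : Liu2021.Thm418AsPrinted D) (Dμ : D.Obj)
    {Lvl : Type*} [Preorder Lvl] (Kof : Lvl → Subgroup D.G)
    (hmono : ∀ ⦃K K' : Lvl⦄, K ≤ K' → Kof K ≤ Kof K') (hoc : ∀ K : Lvl, IsOpenCompact (Kof K))
    (hcof : ∀ K' : Subgroup D.G, IsOpenCompact K' → ∃ K₀ : Lvl, Kof K₀ ≤ K')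
    {H : Type*} [AddCommGroup H] [Module ℂ H] (ρH : Representation ℂ D.G H)
    {W : Lvl → Type*} [∀ K, AddCommGroup (W K)] [∀ K, Module ℂ (W K)]
    (resW : ∀ K : Lvl, H →ₗ[ℂ] W K) (cmCl : ∀ K : Lvl, Set (W K))
    (J : ℂ ⊗[fieldOfValues E D.μ] D.Ω →ₗ[ℂ] H)
    (hJ : ∀ (g : D.G) (x : ℂ ⊗[fieldOfValues E D.μ] D.Ω), J ((D.rhoΩ g).baseChange ℂ x) = ρH g (J x))
    (hJinj : Function.Injective J)
    (hpin : ∀ (K : Lvl) (φ : D.HomK (Kof K) Dμ),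
      resW K (J ((1 : ℂ) ⊗ₜ[fieldOfValues E D.μ] D.res (Kof K) Dμ φ)) ∈ cmCl K)
    (block : Submodule ℂ H) (hblock : block ≤ LinearMap.range J) :
    ∃ K₀ : Lvl, ∀ K ≤ K₀, ∀ x ∈ block, (∀ k ∈ Kof K, ρH k x = x) → resW K x ∈ Submodule.span ℂ (cmCl K) := by
  obtain ⟨K₀, hK₀⟩ :=
    resW_mem_span_of_fixed_of_thm418AsPrinted h Dμ Kof hmono hoc hcof ρH resW cmCl J hJ hJinj hpin
  refine ⟨K₀, fun K hK x hx hfix => ?_⟩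
  obtain ⟨y, rfl⟩ := hblock hx
  exact hK₀ K hK y hfix

/-! ## The same over an ARBITRARY action on `H` (for consumers whose `H` is a `ℂ[𝔾(𝔸_F^∞)]`-module, e.g. the stage-1 record
`LiuAlbaneseModuleDatum`: take `act g x := MonoidAlgebra.of ℂ G g • x`; for a `Representation` take `act g := ρH g`) -/

/-- **`resW_mem_span_of_fixed_of_thm418AsPrinted` for an arbitrary action `act : 𝔾(𝔸_F^∞) → H → H`** (no linearity of the action is
used: only the equivariance `hJ` of the proof map (4.3) and its injectivity move fixedness from `H` to `Ω(μ) ⊗_{M_μ} ℂ`).  Same data,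
readings and conclusion as there, with `ρH g` replaced by `act g`; instantiate `act g x := MonoidAlgebra.of ℂ 𝔾 g • x` to match the
package's `fixedBy (Kof K) H` (`HodgeCM/Literature/AlbaneseUnitaryShimuraModules.lean`:58) token for token.  HC_CM is NOT proved.
[cite: Liu2021, Thm. 4.18 (1) (FJcycle.tex l. 2238–2239) with proof map (4.3) (l. 2247–2266); Lem. 2.4 (1) (l. 1210–1213)] -/
theorem resW_mem_span_of_fixed_of_thm418AsPrinted_act (h : Liu2021.Thm418AsPrinted D) (Dμ : D.Obj)
    {Lvl : Type*} [Preorder Lvl] (Kof : Lvl → Subgroup D.G)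
    (hmono : ∀ ⦃K K' : Lvl⦄, K ≤ K' → Kof K ≤ Kof K') (hoc : ∀ K : Lvl, IsOpenCompact (Kof K))
    (hcof : ∀ K' : Subgroup D.G, IsOpenCompact K' → ∃ K₀ : Lvl, Kof K₀ ≤ K')
    {H : Type*} [AddCommGroup H] [Module ℂ H] (act : D.G → H → H)
    {W : Lvl → Type*} [∀ K, AddCommGroup (W K)] [∀ K, Module ℂ (W K)]
    (resW : ∀ K : Lvl, H →ₗ[ℂ] W K) (cmCl : ∀ K : Lvl, Set (W K))
    (J : ℂ ⊗[fieldOfValues E D.μ] D.Ω →ₗ[ℂ] H)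
    (hJ : ∀ (g : D.G) (x : ℂ ⊗[fieldOfValues E D.μ] D.Ω), J ((D.rhoΩ g).baseChange ℂ x) = act g (J x))
    (hJinj : Function.Injective J)
    (hpin : ∀ (K : Lvl) (φ : D.HomK (Kof K) Dμ),
      resW K (J ((1 : ℂ) ⊗ₜ[fieldOfValues E D.μ] D.res (Kof K) Dμ φ)) ∈ cmCl K) :
    ∃ K₀ : Lvl, ∀ K ≤ K₀, ∀ x : ℂ ⊗[fieldOfValues E D.μ] D.Ω,
      (∀ k ∈ Kof K, act k (J x) = J x) → resW K (J x) ∈ Submodule.span ℂ (cmCl K) := by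
  obtain ⟨-, -, h1, -, -⟩ := h
  obtain ⟨K₀', hK₀', hsmall⟩ := h1 Dμ
  obtain ⟨K₀, hK₀⟩ := hcof K₀' hK₀'
  refine ⟨K₀, fun K hK x hxfix => ?_⟩
  have hrange : Set.range (D.res (Kof K) Dμ) = D.invariants (Kof K) :=
    (hsmall (Kof K) (hoc K) ((hmono hK).trans hK₀)).2
  have hfixΩ : ∀ k : Kof K, (D.rhoΩ (k : D.G)).baseChange ℂ x = x := by
    intro k
    apply hJinj
    rw [hJ, hxfix k k.2]
  have hx := mem_span_one_tmul_of_baseChange_fixed (fun k : Kof K => D.rhoΩ (k : D.G)) hfixΩ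
  have hsub : Submodule.span ℂ {t : ℂ ⊗[fieldOfValues E D.μ] D.Ω |
        ∃ n : D.Ω, (∀ i : Kof K, D.rhoΩ (i : D.G) n = n) ∧ t = (1 : ℂ) ⊗ₜ[fieldOfValues E D.μ] n} ≤
      (Submodule.span ℂ (cmCl K)).comap ((resW K).comp J) := by
    refine Submodule.span_le.mpr ?_
    rintro t ⟨n, hn, rfl⟩
    have hninv : n ∈ D.invariants (Kof K) := (D.mem_invariants_iff _ _).2 fun k hk => hn ⟨k, hk⟩
    rw [← hrange] at hninv
    obtain ⟨φ, hφ⟩ := hninv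
    rw [SetLike.mem_coe, Submodule.mem_comap, LinearMap.comp_apply, ← hφ]
    exact Submodule.subset_span (hpin K φ)
  exact Submodule.mem_comap.1 (hsub hx)

/-- **`block_resW_mem_span_of_thm418AsPrinted` for an arbitrary action `act : 𝔾(𝔸_F^∞) → H → H`**: the package's
`Thm418Combined res cmCl` at one `μ` with `fixedBy (Kof K) H` read as `∀ k ∈ Kof K, act k x = x` (for the record's `ℂ[𝔾]`-module:
`act g x := MonoidAlgebra.of ℂ 𝔾 g • x`), from [Liu2021] Thm. 4.18 (1) AS PRINTED + the proof map (4.3) (`J`, `hJ`, `hJinj`) + the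
class identification `hpin` + `hblock : block ≤ range J`.  HC_CM is NOT proved.
[cite: Liu2021, Thm. 4.18 (1) (FJcycle.tex l. 2238–2239) with proof (l. 2247–2266); Prop. 4.13, proof l. 2145] -/
theorem block_resW_mem_span_of_thm418AsPrinted_act (h : Liu2021.Thm418AsPrinted D) (Dμ : D.Obj)
    {Lvl : Type*} [Preorder Lvl] (Kof : Lvl → Subgroup D.G)
    (hmono : ∀ ⦃K K' : Lvl⦄, K ≤ K' → Kof K ≤ Kof K') (hoc : ∀ K : Lvl, IsOpenCompact (Kof K))
    (hcof : ∀ K' : Subgroup D.G, IsOpenCompact K' → ∃ K₀ : Lvl, Kof K₀ ≤ K')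
    {H : Type*} [AddCommGroup H] [Module ℂ H] (act : D.G → H → H)
    {W : Lvl → Type*} [∀ K, AddCommGroup (W K)] [∀ K, Module ℂ (W K)]
    (resW : ∀ K : Lvl, H →ₗ[ℂ] W K) (cmCl : ∀ K : Lvl, Set (W K))
    (J : ℂ ⊗[fieldOfValues E D.μ] D.Ω →ₗ[ℂ] H)
    (hJ : ∀ (g : D.G) (x : ℂ ⊗[fieldOfValues E D.μ] D.Ω), J ((D.rhoΩ g).baseChange ℂ x) = act g (J x))
    (hJinj : Function.Injective J)
    (hpin : ∀ (K : Lvl) (φ : D.HomK (Kof K) Dμ),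
      resW K (J ((1 : ℂ) ⊗ₜ[fieldOfValues E D.μ] D.res (Kof K) Dμ φ)) ∈ cmCl K)
    (block : Submodule ℂ H) (hblock : block ≤ LinearMap.range J) :
    ∃ K₀ : Lvl, ∀ K ≤ K₀, ∀ x ∈ block, (∀ k ∈ Kof K, act k x = x) → resW K x ∈ Submodule.span ℂ (cmCl K) := by
  obtain ⟨K₀, hK₀⟩ :=
    resW_mem_span_of_fixed_of_thm418AsPrinted_act h Dμ Kof hmono hoc hcof act resW cmCl J hJ hJinj hpin
  refine ⟨K₀, fun K hK x hx hfix => ?_⟩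
  obtain ⟨y, rfl⟩ := hblock hx
  exact hK₀ K hK y hfix

end Thm418Data

end Literature.NumberTheory.Automorphic.Liu2021

end
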